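/-
Copyright: public-audit package `pub-balaban` (b2b-balaban), seat pv09-g4. Released under Apache 2.0 like Mathlib.
-/
import Literature.MathematicalPhysics.QuantumFieldTheory.Balaban1983to89.B6FaceInterpolation

/-!
# B6, p. 245: the sentence before (2.127), replaced by a kernel-checked inequality with an explicit factor

Source under audit: T. Bałaban, *Propagators and renormalization transformations for lattice gauge theories.
II*, Commun. Math. Phys. **96** (1984) 223–250 [B6], proof of Lemma 2.4, p. 245.  Companion of
`B6TreeGaugePoincare` ((2.123)) and `B6FaceInterpolation` ((2.124)); the layers Δ′, the transverse bonds
b ⊂ Δ′ (`lastLayer`, `bondsIn`) and the comb of tree paths (`comb`, `seg`) are taken from there.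

## The printed sentence (verbatim, p. 245, between (2.126) and (2.127))

*"The terms in parentheses on the right-hand side can be written as L^{−2}⟨B, (Δ_{Δ′}^{L^{−1},N} +
Q′*_{Δ′}Q′_{Δ′})B⟩, where the operators are defined on a d − 1-dimensional lattice.  This quadratic form is
bounded from below by L^{−d−1} Σ_{x∈Δ′} |B_μ(x)|², hence"* [(2.127) follows].  Here the parenthesis of (2.126)
is ⅓ (L^{−d} Σ_{b⊂Δ′} |(∂B_μ)(b)|² + L^{−2} |Σ_{x∈Δ′} L^{−(d−1)} B_μ(x)|²).

## Status of the sentence and what this file proves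

The sentence is FALSE as printed (package census G-B6-09; kernel witness `B6.claim_p245_fails_L10`: for L = 10
the form is smaller than L^{−d−1} Σ|B_μ|² on the lowest Neumann mode of Δ′).  The census (G-B6-10, Steps 3/3′)
repairs it with the factor κ_L = min{1, 4L sin²(π/2L)} (spectral input: the Neumann spectrum of the path) or
κ′_L = min{1, 2/((d − 1)L)} (input-free), certified in prose.  THIS FILE kernel-checks the repaired sentence
with the cruder but fully explicit factor

  κ₀(d, L) = 1 / (4 + 6 d (L − 1) L^{d−2})            (`kappa0`),

namely (`layerPoincare`): for every d ≥ 2, L ≥ 1, every block corner y, direction μ and every g : ℤ^d → ℝ,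

  κ₀ · L^{−d−1} Σ_{x∈Δ′} g(x)²  ≤  L^{−d} Σ_{b⊂Δ′} (g(b₊) − g(b₋))²  +  L^{−2} (L^{−(d−1)} Σ_{x∈Δ′} g(x))²,

Δ′ = `lastLayer L y μ`, b ranging over `bondsIn Δ′` (both endpoints in Δ′; these bonds are transverse to μ,
`B6FaceInterpolation.dir_ne_of_mem_bondsIn_lastLayer`).  With g = B_μ|Δ′ this is exactly the census's Step 3
with κ₀ in place of κ_L, i.e. what Step 4 inserts into (2.126) to get (2.127)_κ.  κ₀ is weaker than κ_L and
κ′_L, but positive and depending on d, L only — which is all any downstream use of Lemma 2.4 consumes (G-r2.9).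

## Proof (elementary, no input beyond the tree modules)

Write y* = y + (L − 1)e_μ ∈ Δ′ (`topCorner`).  For x ∈ Δ′ the comb of `B6TreeGaugePoincare` from x to y*
stays inside Δ′ (it never moves in the direction μ), so g(x) − g(y*) telescopes into at most d(L − 1) steps
g(x′ + e_j) − g(x′) over bonds ⟨x′, x′ + e_j⟩ ⊂ Δ′, pairwise distinct along one comb (`telescope`,
`step_mem_bondsIn`); Cauchy–Schwarz gives (g(x) − g(y*))² ≤ d(L − 1) Σ_{b⊂Δ′} |∇g(b)|² (`fluct_le`), hence
D := Σ_{x∈Δ′} (g(x) − g(y*))² ≤ N d (L − 1) G with N = #Δ′ = L^{d−1} (`card_lastLayer`) and G the gradient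
sum.  With a = g(y*), S = Σ g: Σ g² ≤ 2Na² + 2D and (Na)² = (S − Σ(g − a))² ≤ 2S² + 2ND, so
N Σ g² ≤ 4S² + 6ND ≤ 4S² + 6N² d(L − 1) G; multiplying by κ₀ and using 4κ₀ ≤ 1, 6κ₀ d(L − 1)L^{d−2} ≤ 1
gives κ₀ L^{d−1} Σ g² ≤ S² + L^d G (`layerPoincare_cleared`), which is the displayed inequality times L^{2d}.

## HONEST SCOPE

Nothing here is quoted from print as a fact: the printed sentence is false and is NOT used; the inequality
proved is the package's repair with a weaker constant than the census's.  The remaining steps of the repaired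
Lemma 2.4 on the concrete carrier ((2.125), (2.126), the summation (2.127)_κ → `B6.Step2127`) are not in this
file.
-/

open Finset

namespace Literature.MathematicalPhysics.QuantumFieldTheory.Balaban1983to89.B6LayerPoincare

open B6Elimination (block mem_block)
open B6BondElimination (unitVec unitVec_apply add_unitVec_apply add_smul_unitVec_apply)
open B6TreeGaugePoincare (comb seg comb_zero seg_apply_self seg_apply_of_lt seg_apply_of_gt seg_top seg_bot
  seg_add_unitVec toNat_sub_le)
open B6FaceInterpolation (lastLayer bondsIn mem_lastLayer mem_bondsIn)

noncomputable section

variable {d : ℕ} {L : ℕ}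

/-! ## §1  Telescoping of a site function along the comb of tree paths -/

/-- One step of the j-th comb segment for a SITE function h: h(x′ + e_j) − h(x′), x′ = (w_{<j}, w_j + s, x_{>j}).
[folklore] -/
def stepDiff (h : (Fin d → ℤ) → ℝ) (w x : Fin d → ℤ) (j : Fin d) (s : ℕ) : ℝ :=
  h (seg w x j (w j + s + 1)) - h (seg w x j (w j + s))

/-- The j-th segment telescopes: Σ_{s<m} (h(x′_{s+1}) − h(x′_s)) = h(x′_m) − h(x′_0). [folklore] -/
theorem seg_telescope (h : (Fin d → ℤ) → ℝ) (w x : Fin d → ℤ) (j : Fin d) (m : ℕ) :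
    ∑ s ∈ range m, stepDiff h w x j s = h (seg w x j (w j + m)) - h (seg w x j (w j)) := by
  have key := Finset.sum_range_sub (fun s : ℕ => h (seg w x j (w j + s))) m
  simp only [Nat.cast_zero, add_zero, Nat.cast_succ] at key
  rw [← key]
  refine sum_congr rfl fun s _ => ?_
  simp only [stepDiff, add_assoc]

/-- The comb ends at the base point: `comb w x d = w`. [folklore] -/
theorem comb_self (w x : Fin d → ℤ) : comb w x d = w := by
  funext i; simp [comb, i.2]

/-- The comb telescoping, k segments: h(x) = h(comb_k) + Σ_{j<k} Σ_s (steps of segment j), for x ∈ B(w).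
[folklore] -/
theorem telescope_comb {w x : Fin d → ℤ} (hx : x ∈ block L w) (h : (Fin d → ℤ) → ℝ) (k : ℕ) (hk : k ≤ d) :
    h x = h (comb w x k) +
      ∑ j ∈ univ.filter (fun j : Fin d => (j : ℕ) < k), ∑ s ∈ range (x j - w j).toNat, stepDiff h w x j s := by
  induction k with
  | zero => simp [comb_zero]
  | succ k ih =>
    have hkd : k < d := Nat.lt_of_succ_le hk
    set j₀ : Fin d := ⟨k, hkd⟩ with hj₀
    have hfilt : univ.filter (fun j : Fin d => (j : ℕ) < k + 1) =
        insert j₀ (univ.filter (fun j : Fin d => (j : ℕ) < k)) := by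
      ext j
      simp only [mem_filter, mem_univ, true_and, mem_insert, Fin.ext_iff, hj₀]
      omega
    have hnot : j₀ ∉ univ.filter (fun j : Fin d => (j : ℕ) < k) := by simp [hj₀]
    have hb := mem_block.1 hx j₀
    have hn : w j₀ + (((x j₀ - w j₀).toNat : ℕ) : ℤ) = x j₀ := by
      rw [Int.toNat_of_nonneg (by omega)]; ring
    have hseg : h (comb w x k) =
        h (comb w x (k + 1)) + ∑ s ∈ range (x j₀ - w j₀).toNat, stepDiff h w x j₀ s := by
      rw [seg_telescope, hn, seg_top, seg_bot]
      simp only [hj₀]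
      ring
    rw [ih (Nat.le_of_succ_le hk), hfilt, sum_insert hnot, hseg]
    ring

/-- The full telescoping: h(x) − h(w) = Σ_j Σ_{s < x_j − w_j} (h(x′ + e_j) − h(x′)) along the comb from x to
the corner w of its block. [folklore] -/
theorem telescope {w x : Fin d → ℤ} (hx : x ∈ block L w) (h : (Fin d → ℤ) → ℝ) :
    h x - h w = ∑ j : Fin d, ∑ s ∈ range (x j - w j).toNat, stepDiff h w x j s := by
  have key := telescope_comb hx h d le_rfl
  have hf : univ.filter (fun j : Fin d => (j : ℕ) < d) = univ := by
    ext j; simp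
  rw [comb_self, hf] at key
  linarith

/-- Cauchy–Schwarz on the comb: (h(x) − h(w))² ≤ d(L − 1) Σ_j Σ_s (step)² (at most d segments of at most
L − 1 steps each). [folklore] -/
theorem diff_sq_le {w x : Fin d → ℤ} (hx : x ∈ block L w) (h : (Fin d → ℤ) → ℝ) :
    (h x - h w) ^ 2 ≤
      (d : ℝ) * ((L : ℝ) - 1) * ∑ j : Fin d, ∑ s ∈ range (x j - w j).toNat, stepDiff h w x j s ^ 2 := by
  rw [telescope hx h]
  have h1 : (∑ j : Fin d, ∑ s ∈ range (x j - w j).toNat, stepDiff h w x j s) ^ 2 ≤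
      #(univ : Finset (Fin d)) * ∑ j : Fin d, (∑ s ∈ range (x j - w j).toNat, stepDiff h w x j s) ^ 2 :=
    sq_sum_le_card_mul_sum_sq
  rw [card_univ, Fintype.card_fin] at h1
  have h2 : ∀ j : Fin d, (∑ s ∈ range (x j - w j).toNat, stepDiff h w x j s) ^ 2 ≤
      ((L : ℝ) - 1) * ∑ s ∈ range (x j - w j).toNat, stepDiff h w x j s ^ 2 := fun j => by
    refine le_trans sq_sum_le_card_mul_sum_sq ?_
    rw [card_range]
    exact mul_le_mul_of_nonneg_right (toNat_sub_le hx j) (sum_nonneg fun _ _ => sq_nonneg _)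
  calc (∑ j : Fin d, ∑ s ∈ range (x j - w j).toNat, stepDiff h w x j s) ^ 2
      ≤ (d : ℝ) * ∑ j : Fin d, (∑ s ∈ range (x j - w j).toNat, stepDiff h w x j s) ^ 2 := h1
    _ ≤ (d : ℝ) * ∑ j : Fin d, (((L : ℝ) - 1) * ∑ s ∈ range (x j - w j).toNat, stepDiff h w x j s ^ 2) :=
        mul_le_mul_of_nonneg_left (sum_le_sum fun j _ => h2 j) (Nat.cast_nonneg _)
    _ = _ := by rw [← mul_sum]; ring

/-! ## §2  The layer Δ′ and its top corner y* = y + (L − 1)e_μ: the comb of x ∈ Δ′ toward y* stays in Δ′ -/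

/-- The corner y* = y + (L − 1)e_μ of the layer Δ′ = `lastLayer L y μ` (Δ′ ⊂ B(y*) and y* ∈ Δ′). [folklore] -/
def topCorner (L : ℕ) (y : Fin d → ℤ) (μ : Fin d) : Fin d → ℤ := y + ((L : ℤ) - 1) • unitVec μ

/-- Coordinates of y*. [folklore] -/
theorem topCorner_apply (y : Fin d → ℤ) (μ i : Fin d) :
    topCorner L y μ i = y i + if i = μ then (L : ℤ) - 1 else 0 :=
  add_smul_unitVec_apply _ _ _ _

/-- Δ′ ⊂ B(y*): the layer lies in the block whose corner is its own corner y*. [folklore] -/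
theorem mem_block_topCorner (hL : 1 ≤ L) {y x : Fin d → ℤ} {μ : Fin d} (hx : x ∈ lastLayer L y μ) :
    x ∈ block L (topCorner L y μ) := by
  obtain ⟨hb, hμ⟩ := mem_lastLayer.1 hx
  have hb' := mem_block.1 hb
  refine mem_block.2 fun i => ?_
  rw [topCorner_apply]
  have := hb' i
  split_ifs with h
  · rw [h]; omega
  · omega

/-- y* ∈ Δ′. [folklore] -/
theorem topCorner_mem_lastLayer (hL : 1 ≤ L) (y : Fin d → ℤ) (μ : Fin d) :
    topCorner L y μ ∈ lastLayer L y μ := by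
  refine mem_lastLayer.2 ⟨mem_block.2 fun i => ?_, ?_⟩
  · rw [topCorner_apply]; split_ifs <;> omega
  · rw [topCorner_apply, if_pos rfl]; omega

/-- The points of the comb of x ∈ Δ′ toward y* lie in Δ′: for y*_j ≤ t ≤ x_j the segment point
(y*_{<j}, t, x_{>j}) is in Δ′ (its μ-coordinate is y_μ + L − 1 in all three cases μ < j, μ = j, μ > j).
[folklore] -/
theorem seg_mem_lastLayer (hL : 1 ≤ L) {y x : Fin d → ℤ} {μ : Fin d} (hx : x ∈ lastLayer L y μ)
    (j : Fin d) {t : ℤ} (h1 : topCorner L y μ j ≤ t) (h2 : t ≤ x j) :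
    seg (topCorner L y μ) x j t ∈ lastLayer L y μ := by
  obtain ⟨hb, hμ⟩ := mem_lastLayer.1 hx
  have hb' := mem_block.1 hb
  have ht := topCorner_apply (L := L) y μ j
  refine mem_lastLayer.2 ⟨mem_block.2 fun i => ?_, ?_⟩
  · rcases lt_trichotomy i j with hij | hij | hji
    · rw [seg_apply_of_lt _ _ hij, topCorner_apply]
      have := hb' i
      split_ifs with h
      · rw [h]; omega
      · omega
    · have hbi := hb' i
      rw [hij] at hbi ⊢
      rw [seg_apply_self]
      split_ifs at ht <;> omega
    · rw [seg_apply_of_gt _ _ hji]; exact hb' i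
  · rcases lt_trichotomy μ j with hμj | hμj | hjμ
    · rw [seg_apply_of_lt _ _ hμj, topCorner_apply, if_pos rfl]; omega
    · rw [← hμj] at ht h1 h2
      rw [← hμj, seg_apply_self]
      rw [if_pos rfl] at ht
      omega
    · rw [seg_apply_of_gt _ _ hjμ]; exact hμ

/-- The steps of the comb of x ∈ Δ′ toward y* are bonds ⟨x′, x′ + e_j⟩ ⊂ Δ′ (`bondsIn Δ′`). [folklore] -/
theorem step_mem_bondsIn (hL : 1 ≤ L) {y x : Fin d → ℤ} {μ : Fin d} (hx : x ∈ lastLayer L y μ)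
    (j : Fin d) {s : ℕ} (hs : s < (x j - topCorner L y μ j).toNat) :
    (seg (topCorner L y μ) x j (topCorner L y μ j + s), j) ∈ bondsIn (lastLayer L y μ) := by
  have hxb := mem_block.1 (mem_block_topCorner hL hx) j
  have hs' : (s : ℤ) < x j - topCorner L y μ j := by
    have := Int.toNat_of_nonneg (show 0 ≤ x j - topCorner L y μ j by omega); omega
  refine mem_bondsIn.2 ⟨seg_mem_lastLayer hL hx j (by omega) (by omega), ?_⟩
  dsimp only
  rw [seg_add_unitVec]
  exact seg_mem_lastLayer hL hx j (by omega) (by omega)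

/-- Along one segment the steps are pairwise distinct bonds ⊂ Δ′, so for F ≥ 0 the sum over the segment is at
most the sum over all bonds ⊂ Δ′ of direction j. [folklore] -/
theorem sum_steps_le (hL : 1 ≤ L) {y x : Fin d → ℤ} {μ : Fin d} (hx : x ∈ lastLayer L y μ) (j : Fin d)
    (F : (Fin d → ℤ) × Fin d → ℝ) (hF : ∀ b, 0 ≤ F b) :
    ∑ s ∈ range (x j - topCorner L y μ j).toNat, F (seg (topCorner L y μ) x j (topCorner L y μ j + s), j) ≤
      ∑ b ∈ (bondsIn (lastLayer L y μ)).filter (fun b => b.2 = j), F b := by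
  classical
  set φ : ℕ → (Fin d → ℤ) × Fin d := fun s => (seg (topCorner L y μ) x j (topCorner L y μ j + s), j)
    with hφ
  have hinj : Set.InjOn φ ↑(range (x j - topCorner L y μ j).toNat) := by
    intro s _ s' _ h
    have := congr_fun (congr_arg Prod.fst h) j
    simp only [hφ, seg_apply_self] at this
    exact_mod_cast (by omega : (s : ℤ) = s')
  rw [← sum_image hinj]
  refine sum_le_sum_of_subset_of_nonneg (fun b hb => ?_) fun b _ _ => hF b
  obtain ⟨s, hs, rfl⟩ := mem_image.1 hb
  exact mem_filter.2 ⟨step_mem_bondsIn hL hx j (mem_range.1 hs), rfl⟩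

/-! ## §3  The gradient form on Δ′ and the fluctuation bound -/

/-- G(g) = Σ_{b=⟨x′,x′+e_j⟩⊂S} (g(x′ + e_j) − g(x′))², the print's Σ_{b⊂Δ′} |(∂B_μ)(b)|² for g = B_μ, S = Δ′.
[cite: Balaban1984PropagatorsII, (2.126)] -/
def gradSq (g : (Fin d → ℤ) → ℝ) (S : Finset (Fin d → ℤ)) : ℝ :=
  ∑ b ∈ bondsIn S, (g (b.1 + unitVec b.2) - g b.1) ^ 2

/-- G(g) ≥ 0. [folklore] -/
theorem gradSq_nonneg (g : (Fin d → ℤ) → ℝ) (S : Finset (Fin d → ℤ)) : 0 ≤ gradSq g S :=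
  sum_nonneg fun _ _ => sq_nonneg _

/-- The fluctuation bound: for x ∈ Δ′, (g(x) − g(y*))² ≤ d(L − 1) · G(g) (comb telescoping inside Δ′ +
Cauchy–Schwarz; the crude multiplicity "every step is some bond ⊂ Δ′"). [folklore] -/
theorem fluct_le (hL : 1 ≤ L) {y : Fin d → ℤ} {μ : Fin d} (g : (Fin d → ℤ) → ℝ) {x : Fin d → ℤ}
    (hx : x ∈ lastLayer L y μ) :
    (g x - g (topCorner L y μ)) ^ 2 ≤ (d : ℝ) * ((L : ℝ) - 1) * gradSq g (lastLayer L y μ) := by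
  have hL1 : (1 : ℝ) ≤ L := by exact_mod_cast hL
  refine le_trans (diff_sq_le (mem_block_topCorner hL hx) g)
    (mul_le_mul_of_nonneg_left ?_ (mul_nonneg (Nat.cast_nonneg _) (by linarith)))
  have h2 : ∀ j : Fin d, ∑ s ∈ range (x j - topCorner L y μ j).toNat, stepDiff g (topCorner L y μ) x j s ^ 2 ≤
      ∑ b ∈ (bondsIn (lastLayer L y μ)).filter (fun b => b.2 = j), (g (b.1 + unitVec b.2) - g b.1) ^ 2 := by
    intro j
    refine le_of_eq_of_le ?_
      (sum_steps_le hL hx j (fun b => (g (b.1 + unitVec b.2) - g b.1) ^ 2) fun b => sq_nonneg _)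
    refine sum_congr rfl fun s _ => ?_
    simp only [stepDiff, seg_add_unitVec, add_assoc]
  calc ∑ j : Fin d, ∑ s ∈ range (x j - topCorner L y μ j).toNat, stepDiff g (topCorner L y μ) x j s ^ 2
      ≤ ∑ j : Fin d, ∑ b ∈ (bondsIn (lastLayer L y μ)).filter (fun b => b.2 = j),
          (g (b.1 + unitVec b.2) - g b.1) ^ 2 := sum_le_sum fun j _ => h2 j
    _ = gradSq g (lastLayer L y μ) := Finset.sum_fiberwise_of_maps_to (fun _ _ => mem_univ _) _

/-- #Δ′ = L^{d−1} (Δ′ is the product of d − 1 intervals of length L and one point). [folklore] -/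
theorem card_lastLayer (hL : 1 ≤ L) (y : Fin d → ℤ) (μ : Fin d) : #(lastLayer L y μ) = L ^ (d - 1) := by
  classical
  have h : lastLayer L y μ = Fintype.piFinset fun i =>
      if i = μ then ({y μ + (L : ℤ) - 1} : Finset ℤ) else Ico (y i) (y i + L) := by
    ext x
    rw [mem_lastLayer, mem_block, Fintype.mem_piFinset]
    constructor
    · rintro ⟨hb, hμ⟩ i
      split_ifs with hi
      · rw [hi, mem_singleton]; omega
      · exact mem_Ico.2 (hb i)
    · intro hx
      have hxμ := hx μ
      rw [if_pos rfl, mem_singleton] at hxμ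
      refine ⟨fun i => ?_, by omega⟩
      have hxi := hx i
      split_ifs at hxi with hi
      · rw [hi]; omega
      · exact mem_Ico.1 hxi
  have hd : 1 ≤ d := Nat.succ_le_of_lt (lt_of_le_of_lt (Nat.zero_le _) μ.2)
  rw [h, Fintype.card_piFinset, ← Finset.mul_prod_erase univ _ (mem_univ μ), if_pos rfl, card_singleton,
    one_mul]
  rw [prod_congr rfl fun i hi => show #(if i = μ then ({y μ + (L : ℤ) - 1} : Finset ℤ) else Ico (y i) (y i + L))
      = L by rw [if_neg (ne_of_mem_erase hi), Int.card_Ico]; simp]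
  rw [prod_const, card_erase_of_mem (mem_univ μ), card_univ, Fintype.card_fin]

/-! ## §4  The explicit factor κ₀ and the layer Poincaré inequality -/

/-- κ₀(d, L) = 1 / (4 + 6 d (L − 1) L^{d−2}): the explicit (crude) factor replacing the false "1" of the p.245
sentence; the census's sharper κ_L, κ′_L are not used here. [folklore] -/
def kappa0 (d L : ℕ) : ℝ := 1 / (4 + 6 * (d : ℝ) * ((L : ℝ) - 1) * (L : ℝ) ^ (d - 2))

/-- The denominator of κ₀ is ≥ 4. [folklore] -/
theorem kappa0_den_ge (hL : 1 ≤ L) : (4 : ℝ) ≤ 4 + 6 * (d : ℝ) * ((L : ℝ) - 1) * (L : ℝ) ^ (d - 2) := by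
  have hL1 : (1 : ℝ) ≤ L := by exact_mod_cast hL
  have : 0 ≤ 6 * (d : ℝ) * ((L : ℝ) - 1) * (L : ℝ) ^ (d - 2) :=
    mul_nonneg (mul_nonneg (by positivity) (by linarith)) (by positivity)
  linarith

/-- κ₀ > 0. [folklore] -/
theorem kappa0_pos (hL : 1 ≤ L) : 0 < kappa0 d L :=
  one_div_pos.2 (lt_of_lt_of_le (by norm_num) (kappa0_den_ge hL))

/-- κ₀ ≤ 1 (indeed ≤ ¼). [folklore] -/
theorem kappa0_le_one (hL : 1 ≤ L) : kappa0 d L ≤ 1 := by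
  rw [kappa0, div_le_one (lt_of_lt_of_le (by norm_num) (kappa0_den_ge hL))]
  linarith [kappa0_den_ge (d := d) hL]

/-- 4κ₀ ≤ 1. [folklore] -/
theorem four_mul_kappa0_le (hL : 1 ≤ L) : 4 * kappa0 d L ≤ 1 := by
  have hden := kappa0_den_ge (d := d) hL
  rw [kappa0, mul_one_div, div_le_one (by linarith)]
  exact hden

/-- 6 d (L − 1) L^{d−2} κ₀ ≤ 1. [folklore] -/
theorem six_mul_kappa0_le (hL : 1 ≤ L) :
    6 * (d : ℝ) * ((L : ℝ) - 1) * (L : ℝ) ^ (d - 2) * kappa0 d L ≤ 1 := by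
  have hden := kappa0_den_ge (d := d) hL
  rw [kappa0, mul_one_div, div_le_one (by linarith)]
  linarith

/-- The layer Poincaré inequality, cleared of the powers of L^{−1}: for d ≥ 2, L ≥ 1 and every g,
κ₀ L^{d−1} Σ_{x∈Δ′} g(x)² ≤ L^d G(g) + (Σ_{x∈Δ′} g(x))² — DERIVED (the package's repair of the p.245 sentence
with the factor κ₀; the tag names the sentence repaired, which is NOT used). [cite: Balaban1984PropagatorsII, p.245] -/
theorem layerPoincare_cleared (hd : 2 ≤ d) (hL : 1 ≤ L) (y : Fin d → ℤ) (μ : Fin d) (g : (Fin d → ℤ) → ℝ) :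
    kappa0 d L * (L : ℝ) ^ (d - 1) * ∑ x ∈ lastLayer L y μ, g x ^ 2 ≤
      (L : ℝ) ^ d * gradSq g (lastLayer L y μ) + (∑ x ∈ lastLayer L y μ, g x) ^ 2 := by
  set Δ := lastLayer L y μ with hΔ
  set N : ℝ := (L : ℝ) ^ (d - 1) with hNdef
  set a : ℝ := g (topCorner L y μ) with ha
  set S : ℝ := ∑ x ∈ Δ, g x with hS
  set D : ℝ := ∑ x ∈ Δ, (g x - a) ^ 2 with hD
  set G : ℝ := gradSq g Δ with hG
  have hL0 : (0 : ℝ) < L := by exact_mod_cast (Nat.lt_of_lt_of_le Nat.zero_lt_one hL)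
  have hL1 : (1 : ℝ) ≤ L := by exact_mod_cast hL
  have hN : (#Δ : ℝ) = N := by rw [hΔ, card_lastLayer hL]; push_cast; rfl
  have hNpos : 0 < N := pow_pos hL0 _
  have hG0 : 0 ≤ G := gradSq_nonneg g Δ
  have hκ0 : 0 < kappa0 d L := kappa0_pos hL
  -- (1) Σ g² ≤ 2 N a² + 2 D
  have h1 : ∑ x ∈ Δ, g x ^ 2 ≤ 2 * N * a ^ 2 + 2 * D := by
    have hpt : ∀ x ∈ Δ, g x ^ 2 ≤ 2 * a ^ 2 + 2 * (g x - a) ^ 2 := fun x _ => by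
      nlinarith [sq_nonneg (g x - 2 * a)]
    calc ∑ x ∈ Δ, g x ^ 2 ≤ ∑ x ∈ Δ, (2 * a ^ 2 + 2 * (g x - a) ^ 2) := sum_le_sum hpt
      _ = 2 * N * a ^ 2 + 2 * D := by rw [sum_add_distrib, sum_const, nsmul_eq_mul, hN, hD, mul_sum]; ring
  -- (2) (N a)² ≤ 2 S² + 2 N D
  have h2 : (N * a) ^ 2 ≤ 2 * S ^ 2 + 2 * N * D := by
    have hNa : N * a = S - ∑ x ∈ Δ, (g x - a) := by
      rw [sum_sub_distrib, sum_const, nsmul_eq_mul, hN, hS]; ring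
    have hcs : (∑ x ∈ Δ, (g x - a)) ^ 2 ≤ #Δ * D := sq_sum_le_card_mul_sum_sq
    rw [hN] at hcs
    rw [hNa]
    nlinarith [hcs, sq_nonneg (S + ∑ x ∈ Δ, (g x - a))]
  -- (3) D ≤ N d (L − 1) G
  have h3 : D ≤ N * ((d : ℝ) * ((L : ℝ) - 1) * G) := by
    calc D ≤ ∑ x ∈ Δ, (d : ℝ) * ((L : ℝ) - 1) * G := sum_le_sum fun x hx => fluct_le hL g hx
      _ = N * ((d : ℝ) * ((L : ℝ) - 1) * G) := by rw [sum_const, nsmul_eq_mul, hN]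
  -- (4) N Σ g² ≤ 4 S² + 6 N² d (L − 1) G
  have h4 : N * ∑ x ∈ Δ, g x ^ 2 ≤ 4 * S ^ 2 + 6 * (N * (N * ((d : ℝ) * ((L : ℝ) - 1) * G))) := by
    have h3' : N * D ≤ N * (N * ((d : ℝ) * ((L : ℝ) - 1) * G)) := mul_le_mul_of_nonneg_left h3 hNpos.le
    calc N * ∑ x ∈ Δ, g x ^ 2 ≤ N * (2 * N * a ^ 2 + 2 * D) := mul_le_mul_of_nonneg_left h1 hNpos.le
      _ = 2 * (N * a) ^ 2 + 2 * (N * D) := by ring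
      _ ≤ 2 * (2 * S ^ 2 + 2 * N * D) + 2 * (N * D) := by linarith [h2]
      _ = 4 * S ^ 2 + 6 * (N * D) := by ring
      _ ≤ _ := by linarith [h3']
  -- (5) the two conditions on κ₀
  have hc1 := four_mul_kappa0_le (d := d) hL
  have hc2 : 6 * kappa0 d L * (N * (N * ((d : ℝ) * ((L : ℝ) - 1)))) ≤ (L : ℝ) ^ d := by
    have hNN : (L : ℝ) ^ (d - 2) * (L : ℝ) ^ d = N * N := by
      rw [hNdef, ← pow_add, ← pow_add]; congr 1; omega
    have h6 := six_mul_kappa0_le (d := d) hL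
    have hLd : (0 : ℝ) < (L : ℝ) ^ d := pow_pos hL0 _
    calc 6 * kappa0 d L * (N * (N * ((d : ℝ) * ((L : ℝ) - 1))))
        = 6 * kappa0 d L * ((d : ℝ) * ((L : ℝ) - 1)) * (N * N) := by ring
      _ = 6 * kappa0 d L * ((d : ℝ) * ((L : ℝ) - 1)) * ((L : ℝ) ^ (d - 2) * (L : ℝ) ^ d) := by rw [hNN]
      _ = (6 * (d : ℝ) * ((L : ℝ) - 1) * (L : ℝ) ^ (d - 2) * kappa0 d L) * (L : ℝ) ^ d := by ring
      _ ≤ 1 * (L : ℝ) ^ d := mul_le_mul_of_nonneg_right h6 hLd.le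
      _ = (L : ℝ) ^ d := one_mul _
  have hS2 : 0 ≤ S ^ 2 := sq_nonneg _
  calc kappa0 d L * N * ∑ x ∈ Δ, g x ^ 2 = kappa0 d L * (N * ∑ x ∈ Δ, g x ^ 2) := by ring
    _ ≤ kappa0 d L * (4 * S ^ 2 + 6 * (N * (N * ((d : ℝ) * ((L : ℝ) - 1) * G)))) :=
        mul_le_mul_of_nonneg_left h4 hκ0.le
    _ = (4 * kappa0 d L) * S ^ 2 + (6 * kappa0 d L * (N * (N * ((d : ℝ) * ((L : ℝ) - 1))))) * G := by ring
    _ ≤ 1 * S ^ 2 + (L : ℝ) ^ d * G :=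
        add_le_add (mul_le_mul_of_nonneg_right hc1 hS2) (mul_le_mul_of_nonneg_right hc2 hG0)
    _ = (L : ℝ) ^ d * G + S ^ 2 := by ring

/-- **The p.245 sentence, repaired and kernel-checked (factor κ₀).**  For d ≥ 2, L ≥ 1, every block corner y,
direction μ and every g : ℤ^d → ℝ:
κ₀(d,L) · L^{−d−1} Σ_{x∈Δ′} g(x)² ≤ L^{−d} Σ_{b⊂Δ′} (g(b₊) − g(b₋))² + L^{−2} (L^{−(d−1)} Σ_{x∈Δ′} g(x))²
— the census's Step 3 (G-B6-10) with κ₀ in place of κ_L; with g = B_μ|Δ′ it is what turns (2.126) into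
(2.127)_κ.  DERIVED: the printed factor 1 is false (`B6.claim_p245_fails_L10`); the tag names the sentence
repaired, which is NOT used. [cite: Balaban1984PropagatorsII, p.245] -/
theorem layerPoincare (hd : 2 ≤ d) (hL : 1 ≤ L) (y : Fin d → ℤ) (μ : Fin d) (g : (Fin d → ℤ) → ℝ) :
    kappa0 d L * ((L : ℝ)⁻¹) ^ (d + 1) * ∑ x ∈ lastLayer L y μ, g x ^ 2 ≤
      ((L : ℝ)⁻¹) ^ d * gradSq g (lastLayer L y μ) +
        ((L : ℝ)⁻¹) ^ 2 * (((L : ℝ)⁻¹) ^ (d - 1) * ∑ x ∈ lastLayer L y μ, g x) ^ 2 := by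
  have key := layerPoincare_cleared hd hL y μ g
  have hL0 : (0 : ℝ) < L := by exact_mod_cast (Nat.lt_of_lt_of_le Nat.zero_lt_one hL)
  have hL2d : (0 : ℝ) < (L : ℝ) ^ (2 * d) := pow_pos hL0 _
  obtain ⟨k, rfl⟩ : ∃ k, d = k + 2 := ⟨d - 2, by omega⟩
  have e1 : k + 2 - 1 = k + 1 := by omega
  rw [e1] at key ⊢
  have hne : (L : ℝ) ≠ 0 := hL0.ne'
  have lhs : kappa0 (k + 2) L * ((L : ℝ)⁻¹) ^ (k + 2 + 1) * ∑ x ∈ lastLayer L y μ, g x ^ 2 =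
      (kappa0 (k + 2) L * (L : ℝ) ^ (k + 1) * ∑ x ∈ lastLayer L y μ, g x ^ 2) / (L : ℝ) ^ (2 * (k + 2)) := by
    rw [eq_div_iff hL2d.ne']
    simp only [inv_pow]
    field_simp
    ring
  have rhs : ((L : ℝ)⁻¹) ^ (k + 2) * gradSq g (lastLayer L y μ) +
      ((L : ℝ)⁻¹) ^ 2 * (((L : ℝ)⁻¹) ^ (k + 1) * ∑ x ∈ lastLayer L y μ, g x) ^ 2 =
      ((L : ℝ) ^ (k + 2) * gradSq g (lastLayer L y μ) + (∑ x ∈ lastLayer L y μ, g x) ^ 2) /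
        (L : ℝ) ^ (2 * (k + 2)) := by
    rw [eq_div_iff hL2d.ne']
    simp only [inv_pow]
    field_simp
    ring
  rw [lhs, rhs]
  exact div_le_div_of_nonneg_right key hL2d.le

end

end Literature.MathematicalPhysics.QuantumFieldTheory.Balaban1983to89.B6LayerPoincare
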